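import Summits.NavierStokesRegularity.NavierStokesRegularity.Theorems.LerayQuarterDissipationFiniteDissipationLiouvilleHullCategoryCritical
import Literature.Dynamics.Ergodic.InvariantMeasuresCompactConvex
import HarnessLib

/-!
# Crux `FiniteDissipationLiouville` (stmt-NavierStokesRegularity-22144), line `birth`:
# INVARIANT MEASURES ON THE SCALING HULL — a quasi-regular (generic) critical element

Helper file (theorems only, `--supports` the crux). `𝒟_{C,K}` = Type-I ancient mild fields in
the KNSS gauge (`IsTypeIAncientMild C w`) with Leray's quarter-rate dissipation law
`∫‖∇w(s)‖² ≤ K/√(−s)`, acted on by the scalings `w ↦ w_c` (`nsRescale`). By the tree the crux is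
the emptiness of the classes of SINGULAR, UNIFORMLY RECURRENT members (critical elements); the
line has typed the Lyapunov exit (`…Lyapunov`), the closing exit (`…ClosingReduction`) and Baire
category / Birkhoff minimality on the compact scaling hull (`…HullCategory*`, lead g11). This file
adds the third classical dynamical tool — INVARIANT MEASURES (Kryloff–Bogoliouboff) and BIRKHOFF's
pointwise ergodic theorem — in field-level clauses: `exists_quasiRegular` — a singular, uniformly
recurrent `u ∈ 𝒟_{C,K}` has, for every scaling step `λ > 0`, a scaling limit `W ∈ 𝒟_{C,K}` which
is again SINGULAR and UNIFORMLY RECURRENT and QUASI-REGULAR: every observable `G` of fields that is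
continuous along `𝒟_{C,K}` for uniform convergence on the slab pieces `[−(n+2), −1/(n+2)] × B̄(0,n+2)`
is bounded on the scaling orbit of `W` and its Cesàro means `N⁻¹ Σ_{k<N} G(W_{λ^k})` CONVERGE.
Inside the proof: the hull of `u` in the model `Π n, C(piece n, ℝ³)` is a compact metrisable
space on which rescaling by `λ` acts continuously; Kryloff–Bogoliouboff (tree,
`UniqueErgodicity.exists_isProbabilityMeasure_map_eq`) gives an invariant Borel probability
measure — a SCALING-STATIONARY LAW ON CRITICAL ELEMENTS (a statistically self-similar
finite-dissipation Type-I singularity); Birkhoff (tree, `birkhoff_ergodic_theorem_holds`) and the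
separability of `C(hull, ℝ)` give a generic point; every hull point is a critical element
(`persistent_singularity`, `HullCategory.recurrent_of_orbitLimit`). Averaged identities (zero
mean flux) and the packaging for the crux are in `…ErgodicHullPortrait`.

Honest framing: PORTRAIT / TOOL — no identity with a signed source is known for Leray's
similarity flow; verdict FRONTIER unchanged (blocked on `∀ c>1, TypeIDSSLiouville c`, NECESSARY by
`…Hardness`). No summit is proved by this file; Navier–Stokes regularity is NOT proved here.

References: N. Kryloff, N. Bogoliouboff, Ann. of Math. 38 (1937) 65–113 [KryloffBogoliouboff1937];
P. Walters, *An Introduction to Ergodic Theory*, GTM 79 (1982), §6.2 Cor. 6.9.1, §1.6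
[Walters1982]; H. Furstenberg (1981), Ch. 1 §4 [Furstenberg1981]; G. Koch, N. Nadirashvili,
G. Seregin, V. Šverák, Acta Math. 203 (2009) = arXiv:0709.3599, §4 [KochNadirashviliSereginSverak2009].
-/

noncomputable section

-- the summit and its single problem share the name (D-0017 nested layout)
set_option linter.dupNamespace false

namespace Summit.NavierStokesRegularity.NavierStokesRegularity.Theorems.FiniteDissipationLiouville.ErgodicHull

open scoped Topology
open MeasureTheory Set Function Filter Metric TopologicalSpace Topology
open Literature.Analysis.FluidPDE
open Summit.NavierStokesRegularity.NavierStokesRegularity.Theorems.RecurrentReductionD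

/-! ### §1 Cesàro bookkeeping -/

/-- Cesàro means of two sequences at sup-distance `≤ δ` are at distance `≤ δ`. [folklore] -/
theorem abs_cesaro_sub_cesaro_le {a b : ℕ → ℝ} {δ : ℝ} (h : ∀ k, |a k - b k| ≤ δ) (N : ℕ) :
    |(N : ℝ)⁻¹ * ∑ k ∈ Finset.range N, a k - (N : ℝ)⁻¹ * ∑ k ∈ Finset.range N, b k| ≤ δ := by
  have hδ : 0 ≤ δ := (abs_nonneg _).trans (h 0)
  rcases Nat.eq_zero_or_pos N with rfl | hN
  · simpa using hδ
  have hN' : (0 : ℝ) < N := by exact_mod_cast hN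
  rw [← mul_sub, ← Finset.sum_sub_distrib, abs_mul, abs_inv, Nat.abs_cast,
    inv_mul_le_iff₀ hN']
  calc |∑ k ∈ Finset.range N, (a k - b k)| ≤ ∑ k ∈ Finset.range N, |a k - b k| :=
        Finset.abs_sum_le_sum_abs _ _
    _ ≤ ∑ _k ∈ Finset.range N, δ := Finset.sum_le_sum fun k _ => h k
    _ = N * δ := by rw [Finset.sum_const, Finset.card_range, nsmul_eq_mul]

/-! ### §2 The quasi-regular critical element -/

/-- **A QUASI-REGULAR (GENERIC) CRITICAL ELEMENT — invariant measures on the scaling hull.** Let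
`u ∈ 𝒟_{C,K}` be SINGULAR at the origin and UNIFORMLY RECURRENT under the scaling flow (the
item's window clause), and let `λ > 0`. Then some scaling limit `W ∈ 𝒟_{C,K}` of `u` (pointwise
limit on the open past of rescalings `u_{l_k}`) is SINGULAR, UNIFORMLY RECURRENT with the same
clause, and QUASI-REGULAR for the step `λ`: for every observable `G` of fields continuous along
`𝒟_{C,K}` for uniform convergence on the slab pieces, (a) `G` is bounded on the scaling orbit
`{W_c : c > 0}` and (b) the Cesàro means `N⁻¹ Σ_{k<N} G(W_{λ^k})` converge (compact metrisable
hull; Kryloff–Bogoliouboff invariant measure for the rescaling map; Birkhoff's theorem along a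
countable dense subset of `C(hull, ℝ)`; persistence of the singularity and minimality).
[cite: KryloffBogoliouboff1937, §1 (existence of invariant measures on compact phase spaces)]
[cite: Walters1982, §6.2 Corollary 6.9.1; §1.6 Theorem 1.14 (Birkhoff)]
[cite: KochNadirashviliSereginSverak2009, Prop. 4.1 and Lemma 6.1 (arXiv:0709.3599 pp. 8, 11)] -/
theorem exists_quasiRegular {C K lam : ℝ} (hlam : 0 < lam)
    {u : ℝ → EuclideanSpace ℝ (Fin 3) → EuclideanSpace ℝ (Fin 3)}
    (hu : IsTypeIAncientMild C u)
    (hlaw : ∀ s : ℝ, s < 0 → ∫⁻ x, ‖fderiv ℝ (u s) x‖ₑ ^ 2 ≤ ENNReal.ofReal (K / Real.sqrt (-s)))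
    (hsing : ∀ r > 0, ∀ M : ℝ, ∃ t ∈ Ioo (-(r ^ 2)) (0 : ℝ),
      ∃ x ∈ ball (0 : EuclideanSpace ℝ (Fin 3)) r, M < ‖u t x‖)
    (hrec : ∀ ε > 0, ∀ R > 1, ∃ L > 0, ∀ a : ℝ, ∃ σ ∈ Icc a (a + L),
      ∀ s ∈ Icc (-(R ^ 2)) (-(R⁻¹) ^ 2), ∀ y ∈ closedBall (0 : EuclideanSpace ℝ (Fin 3)) R,
        ‖Real.exp σ • u (Real.exp (2 * σ) * s) (Real.exp σ • y) - u s y‖ ≤ ε) :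
    ∃ W : ℝ → EuclideanSpace ℝ (Fin 3) → EuclideanSpace ℝ (Fin 3),
      IsTypeIAncientMild C W ∧
      (∀ s : ℝ, s < 0 → ∫⁻ x, ‖fderiv ℝ (W s) x‖ₑ ^ 2 ≤ ENNReal.ofReal (K / Real.sqrt (-s))) ∧
      (∀ r > 0, ∀ M : ℝ, ∃ t ∈ Ioo (-(r ^ 2)) (0 : ℝ),
        ∃ x ∈ ball (0 : EuclideanSpace ℝ (Fin 3)) r, M < ‖W t x‖) ∧
      (∀ ε > 0, ∀ R > 1, ∃ L > 0, ∀ a : ℝ, ∃ σ ∈ Icc a (a + L),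
        ∀ s ∈ Icc (-(R ^ 2)) (-(R⁻¹) ^ 2), ∀ y ∈ closedBall (0 : EuclideanSpace ℝ (Fin 3)) R,
          ‖Real.exp σ • W (Real.exp (2 * σ) * s) (Real.exp σ • y) - W s y‖ ≤ ε) ∧
      (∃ l : ℕ → ℝ, (∀ k, 0 < l k) ∧
        ∀ t < 0, ∀ x, Tendsto (fun k => nsRescale (l k) u t x) atTop (𝓝 (W t x))) ∧
      ∀ G : (ℝ → EuclideanSpace ℝ (Fin 3) → EuclideanSpace ℝ (Fin 3)) → ℝ,
        (∀ (v : ℕ → ℝ → EuclideanSpace ℝ (Fin 3) → EuclideanSpace ℝ (Fin 3))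
            (w : ℝ → EuclideanSpace ℝ (Fin 3) → EuclideanSpace ℝ (Fin 3)),
          (∀ j, IsTypeIAncientMild C (v j)) →
          (∀ j, ∀ s : ℝ, s < 0 →
            ∫⁻ x, ‖fderiv ℝ (v j s) x‖ₑ ^ 2 ≤ ENNReal.ofReal (K / Real.sqrt (-s))) →
          IsTypeIAncientMild C w →
          (∀ s : ℝ, s < 0 → ∫⁻ x, ‖fderiv ℝ (w s) x‖ₑ ^ 2 ≤ ENNReal.ofReal (K / Real.sqrt (-s))) →
          (∀ n : ℕ, TendstoUniformlyOn (fun j z => v j z.1 z.2) (fun z => w z.1 z.2) atTop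
            (Icc (-((n : ℝ) + 2)) (-(1 / ((n : ℝ) + 2))) ×ˢ
              closedBall (0 : EuclideanSpace ℝ (Fin 3)) ((n : ℝ) + 2))) →
          Tendsto (fun j => G (v j)) atTop (𝓝 (G w))) →
        (∃ B : ℝ, ∀ c : ℝ, 0 < c → |G (nsRescale c W)| ≤ B) ∧
        ∃ ℓ : ℝ, Tendsto (fun N : ℕ => (N : ℝ)⁻¹ * ∑ k ∈ Finset.range N, G (nsRescale (lam ^ k) W))
          atTop (𝓝 ℓ) := by
  classical
  -- dilated slab pieces lie in larger slab pieces (`HullCategory.slabPiece_mapsTo_dilate`)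
  have hdil : ∀ {l : ℝ}, 0 < l → ∀ n : ℕ, ∃ m : ℕ, ∀ z ∈ Icc (-((n : ℝ) + 2)) (-(1 / ((n : ℝ) + 2))) ×ˢ
        closedBall (0 : EuclideanSpace ℝ (Fin 3)) ((n : ℝ) + 2),
      ((l ^ 2 * z.1, l • z.2) : ℝ × EuclideanSpace ℝ (Fin 3)) ∈
        Icc (-((m : ℝ) + 2)) (-(1 / ((m : ℝ) + 2))) ×ˢ
          closedBall (0 : EuclideanSpace ℝ (Fin 3)) ((m : ℝ) + 2) := by
    intro l hl n
    obtain ⟨m, hm⟩ := HullCategory.slabPiece_mapsTo_dilate hl n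
    exact ⟨m, fun z hz => hm hz⟩
  -- ## the class, the slab pieces and the model space
  set P : (ℝ → EuclideanSpace ℝ (Fin 3) → EuclideanSpace ℝ (Fin 3)) → Prop := fun p =>
    IsTypeIAncientMild C p ∧
      ∀ s : ℝ, s < 0 → ∫⁻ x, ‖fderiv ℝ (p s) x‖ₑ ^ 2 ≤ ENNReal.ofReal (K / Real.sqrt (-s))
    with hP
  have hPz : ∀ p, P p → ∀ c : ℝ, 0 < c → P (nsRescale c p) := by
    rintro p ⟨h1, h2⟩ c hc
    exact ⟨isTypeIAncientMild_nsRescale h1 hc, dissipationLaw_nsRescale h2 hc⟩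
  set T : ℕ → Set (ℝ × EuclideanSpace ℝ (Fin 3)) := fun n =>
    Icc (-((n : ℝ) + 2)) (-(1 / ((n : ℝ) + 2))) ×ˢ
      closedBall (0 : EuclideanSpace ℝ (Fin 3)) ((n : ℝ) + 2) with hT
  haveI hTc : ∀ n, CompactSpace (T n) := fun n =>
    isCompact_iff_compactSpace.1 (isCompact_slabPiece n)
  have hTsub : ∀ n, T n ⊆ Iio (0:ℝ) ×ˢ (univ : Set (EuclideanSpace ℝ (Fin 3))) := fun n z hz =>
    ⟨neg_of_mem_slabPiece hz, mem_univ _⟩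
  have hres : ∀ (p : ℝ → EuclideanSpace ℝ (Fin 3) → EuclideanSpace ℝ (Fin 3)), P p →
      ∀ n : ℕ, Continuous fun z : T n => p z.1.1 z.1.2 :=
    fun p hp n => continuousOn_iff_continuous_restrict.1 (hp.1.continuousOn_uncurry.mono (hTsub n))
  let Y := (n : ℕ) → C(T n, EuclideanSpace ℝ (Fin 3))
  let Φ : (p : ℝ → EuclideanSpace ℝ (Fin 3) → EuclideanSpace ℝ (Fin 3)) → P p → Y :=
    fun p hp n => ⟨fun z => p z.1.1 z.1.2, hres p hp n⟩
  have hpast_of_eq : ∀ p hp q hq, Φ p hp = Φ q hq → ∀ t : ℝ, t < 0 → ∀ x, p t x = q t x := by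
    intro p hp q hq heq t ht x
    obtain ⟨n, hn⟩ := exists_mem_slabPiece (E := EuclideanSpace ℝ (Fin 3)) ht x
    exact DFunLike.congr_fun (congrFun heq n) ⟨(t, x), hn⟩
  -- convergence in the model = uniform convergence on every piece
  have htend : ∀ (Fj : ℕ → ℝ → EuclideanSpace ℝ (Fin 3) → EuclideanSpace ℝ (Fin 3))
      (hFj : ∀ j, P (Fj j)) (G : ℝ → EuclideanSpace ℝ (Fin 3) → EuclideanSpace ℝ (Fin 3)) (hG : P G),
      Tendsto (fun j => Φ (Fj j) (hFj j)) atTop (𝓝 (Φ G hG)) ↔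
        ∀ n, TendstoUniformlyOn (fun j z => Fj j z.1 z.2) (fun z => G z.1 z.2) atTop (T n) := by
    intro Fj hFj G hG
    rw [tendsto_pi_nhds]
    refine forall_congr' fun n => ?_
    rw [ContinuousMap.tendsto_iff_tendstoUniformly, tendstoUniformlyOn_iff_tendstoUniformly_comp_coe]
    exact Iff.rfl
  -- uniform convergence on the pieces passes to rescalings (dilated pieces)
  have hresc : ∀ (Fj : ℕ → ℝ → EuclideanSpace ℝ (Fin 3) → EuclideanSpace ℝ (Fin 3))
      (G : ℝ → EuclideanSpace ℝ (Fin 3) → EuclideanSpace ℝ (Fin 3)),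
      (∀ n, TendstoUniformlyOn (fun j z => Fj j z.1 z.2) (fun z => G z.1 z.2) atTop (T n)) →
      ∀ {c : ℝ}, 0 < c →
      ∀ n, TendstoUniformlyOn (fun j z => nsRescale c (Fj j) z.1 z.2)
        (fun z => nsRescale c G z.1 z.2) atTop (T n) := by
    intro Fj G h c hc n
    obtain ⟨m, hm⟩ := hdil hc n
    rw [Metric.tendstoUniformlyOn_iff]
    intro ε hε
    filter_upwards [Metric.tendstoUniformlyOn_iff.1 (h m) (ε / c) (div_pos hε hc)] with j hj z hz
    have h1 := hj (c ^ 2 * z.1, c • z.2) (hm z hz)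
    rw [nsRescale_apply, nsRescale_apply, dist_smul₀, Real.norm_of_nonneg hc.le]
    calc c * dist (G (c ^ 2 * z.1) (c • z.2)) (Fj j (c ^ 2 * z.1) (c • z.2))
        < c * (ε / c) := mul_lt_mul_of_pos_left h1 hc
      _ = ε := mul_div_cancel₀ _ hc.ne'
  -- ## the curve of `u` and its hull
  have hu' : P u := ⟨hu, hlaw⟩
  let γ : ℝ → Y := fun σ => Φ (nsRescale (Real.exp σ) u) (hPz u hu' _ (Real.exp_pos σ))
  set H : Set Y := closure (range γ) with hH
  -- KEY: subsequential limits of orbit sequences (KNSS compactness, `orbitLimit`)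
  have hkey : ∀ σs : ℕ → ℝ, ∃ (W : ℝ → EuclideanSpace ℝ (Fin 3) → EuclideanSpace ℝ (Fin 3))
      (hW : P W) (ψ : ℕ → ℕ), StrictMono ψ ∧
      (∀ n : ℕ, TendstoUniformlyOn (fun j z => nsRescale (Real.exp (σs (ψ j))) u z.1 z.2)
        (fun z => W z.1 z.2) atTop (T n)) ∧
      (∀ t < 0, ∀ x, Tendsto (fun j => nsRescale (Real.exp (σs (ψ j))) u t x) atTop (𝓝 (W t x))) ∧
      Tendsto (fun j => γ (σs (ψ j))) atTop (𝓝 (Φ W hW)) := by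
    intro σs
    obtain ⟨ψ, hψ, W, hW, hlawW, hWu, hpt⟩ :=
      orbitLimit hu hlaw (fun k => Real.exp (σs k)) (fun k => Real.exp_pos _)
    refine ⟨W, ⟨hW, hlawW⟩, ψ, hψ, hWu, hpt, ?_⟩
    exact (htend (fun j => nsRescale (Real.exp (σs (ψ j))) u)
      (fun j => hPz u hu' _ (Real.exp_pos _)) W ⟨hW, hlawW⟩).2 hWu
  -- ## compactness of the hull (sequential compactness in the metrisable model)
  have hKc : IsCompact H := by
    letI mY : PseudoMetricSpace Y := pseudoMetrizableSpacePseudoMetric _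
    refine IsSeqCompact.isCompact fun x hx => ?_
    have hnear : ∀ k : ℕ, ∃ σ : ℝ, dist (x k) (γ σ) < 1 / ((k : ℝ) + 1) := by
      intro k
      have hk : (0 : ℝ) < 1 / ((k : ℝ) + 1) := by positivity
      obtain ⟨b, hb, hd⟩ := Metric.mem_closure_iff.1 (hx k) (1 / ((k : ℝ) + 1)) hk
      obtain ⟨σ, rfl⟩ := hb
      exact ⟨σ, hd⟩
    choose σs hσs using hnear
    obtain ⟨W, hW, ψ, hψ, -, -, hlim⟩ := hkey σs
    refine ⟨Φ W hW, ?_, ψ, hψ, ?_⟩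
    · exact isClosed_closure.mem_of_tendsto hlim
        (Eventually.of_forall fun j => subset_closure ⟨_, rfl⟩)
    · refine hlim.congr_dist ?_
      have h1 : Tendsto (fun j => 1 / (((ψ j : ℕ) : ℝ) + 1)) atTop (𝓝 0) :=
        (tendsto_one_div_add_atTop_nhds_zero_nat (𝕜 := ℝ)).comp hψ.tendsto_atTop
      refine squeeze_zero (fun j => dist_nonneg) (fun j => ?_) h1
      rw [dist_comm]
      exact (hσs (ψ j)).le
  -- ## the hull is invariant under rescalings of limits of orbit sequences
  have hclos : ∀ (W : ℝ → EuclideanSpace ℝ (Fin 3) → EuclideanSpace ℝ (Fin 3)) (hW : P W)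
      (l : ℕ → ℝ), (∀ k, 0 < l k) →
      (∀ n : ℕ, TendstoUniformlyOn (fun k z => nsRescale (l k) u z.1 z.2) (fun z => W z.1 z.2)
        atTop (T n)) →
      ∀ {c : ℝ} (hc : 0 < c), Φ (nsRescale c W) (hPz W hW c hc) ∈ H := by
    intro W hW l hl hWu c hc
    have h1 : ∀ n, TendstoUniformlyOn (fun k z => nsRescale (c * l k) u z.1 z.2)
        (fun z => nsRescale c W z.1 z.2) atTop (T n) := by
      intro n
      have h := hresc (fun k => nsRescale (l k) u) W hWu hc n
      refine h.congr (Eventually.of_forall fun k => fun z _ => ?_)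
      show nsRescale c (nsRescale (l k) u) z.1 z.2 = nsRescale (c * l k) u z.1 z.2
      rw [show c * l k = l k * c from mul_comm _ _, nsRescale_mul]
    have h2 := (htend (fun k => nsRescale (c * l k) u) (fun k => hPz u hu' _ (mul_pos hc (hl k)))
      (nsRescale c W) (hPz W hW c hc)).2 h1
    have hΦcongr : ∀ p hp q hq, p = q → Φ p hp = Φ q hq := by
      intro p hp q hq hpq; subst hpq; rfl
    refine mem_closure_of_tendsto h2 (Eventually.of_forall fun k => ⟨Real.log (c * l k), ?_⟩)
    exact hΦcongr _ (hPz u hu' _ (Real.exp_pos _)) _ (hPz u hu' _ (mul_pos hc (hl k)))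
      (by rw [Real.exp_log (mul_pos hc (hl k))])
  -- ## every hull point is represented by a singular, uniformly recurrent scaling limit of `u`
  have hrep : ∀ y ∈ H, ∃ (W : ℝ → EuclideanSpace ℝ (Fin 3) → EuclideanSpace ℝ (Fin 3)) (hW : P W),
      (∀ r > 0, ∀ M : ℝ, ∃ t ∈ Ioo (-(r ^ 2)) (0 : ℝ),
        ∃ x ∈ ball (0 : EuclideanSpace ℝ (Fin 3)) r, M < ‖W t x‖) ∧
      (∀ ε > 0, ∀ R > 1, ∃ L > 0, ∀ a : ℝ, ∃ σ ∈ Icc a (a + L),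
        ∀ s ∈ Icc (-(R ^ 2)) (-(R⁻¹) ^ 2), ∀ y ∈ closedBall (0 : EuclideanSpace ℝ (Fin 3)) R,
          ‖Real.exp σ • W (Real.exp (2 * σ) * s) (Real.exp σ • y) - W s y‖ ≤ ε) ∧
      (∃ l : ℕ → ℝ, (∀ k, 0 < l k) ∧
        (∀ n : ℕ, TendstoUniformlyOn (fun k z => nsRescale (l k) u z.1 z.2) (fun z => W z.1 z.2)
          atTop (T n)) ∧
        ∀ t < 0, ∀ x, Tendsto (fun k => nsRescale (l k) u t x) atTop (𝓝 (W t x))) ∧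
      Φ W hW = y := by
    intro y hy
    letI mY : PseudoMetricSpace Y := pseudoMetrizableSpacePseudoMetric _
    obtain ⟨xs, hxs, hxy⟩ := mem_closure_iff_seq_limit.1 hy
    choose σs hσs using hxs
    obtain ⟨W, hW, ψ, hψ, hWu, hpt, hlim⟩ := hkey σs
    have hxy' : Tendsto (fun j => γ (σs (ψ j))) atTop (𝓝 y) :=
      (hxy.comp hψ.tendsto_atTop).congr fun j => (hσs (ψ j)).symm
    refine ⟨W, hW, ?_, ?_, ⟨fun j => Real.exp (σs (ψ j)), fun j => Real.exp_pos _, hWu, hpt⟩,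
      (tendsto_nhds_unique hlim hxy')⟩
    · exact persistent_singularity hu hlaw hsing (fun j => Real.exp (σs (ψ j)))
        (fun j => Real.exp_pos _) W hWu
    · exact HullCategory.recurrent_of_orbitLimit hu hlaw hrec (fun j => Real.exp (σs (ψ j)))
        (fun j => Real.exp_pos _) hW.1 hW.2 hWu
  -- ## the compact metrisable phase space `X = hull`, the rescaling map on it
  let X := {y : Y // y ∈ H}
  haveI : CompactSpace X := isCompact_iff_compactSpace.1 hKc
  have hγ0 : γ 0 ∈ H := subset_closure ⟨0, rfl⟩
  haveI : Nonempty X := ⟨⟨γ 0, hγ0⟩⟩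
  letI mX : MetricSpace X := TopologicalSpace.metrizableSpaceMetric X
  letI : MeasurableSpace X := borel X
  haveI : BorelSpace X := ⟨rfl⟩
  choose rep hrepP hrepS hrepR hrepL hrepΦ using hrep
  -- the representative of a hull point, as a function on `X`
  let ρ : X → (ℝ → EuclideanSpace ℝ (Fin 3) → EuclideanSpace ℝ (Fin 3)) := fun y => rep y.1 y.2
  have hρP : ∀ y : X, P (ρ y) := fun y => hrepP y.1 y.2
  have hρΦ : ∀ y : X, Φ (ρ y) (hρP y) = y.1 := fun y => hrepΦ y.1 y.2
  have hρmem : ∀ (y : X) {c : ℝ} (hc : 0 < c), Φ (nsRescale c (ρ y)) (hPz _ (hρP y) c hc) ∈ H := by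
    intro y c hc
    obtain ⟨l, hl, hWu, -⟩ := hrepL y.1 y.2
    exact hclos (ρ y) (hρP y) l hl hWu hc
  -- the rescaling map `𝒯 : X → X`
  let Tm : X → X := fun y => ⟨Φ (nsRescale lam (ρ y)) (hPz _ (hρP y) lam hlam), hρmem y hlam⟩
  -- convergence in `X` = uniform convergence of the representatives on every piece
  have hXtend : ∀ (y : ℕ → X) (a : X), Tendsto y atTop (𝓝 a) ↔
      ∀ n, TendstoUniformlyOn (fun j z => ρ (y j) z.1 z.2) (fun z => ρ a z.1 z.2) atTop (T n) := by
    intro y a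
    rw [tendsto_subtype_rng, ← htend (fun j => ρ (y j)) (fun j => hρP (y j)) (ρ a) (hρP a)]
    simp only [hρΦ]
  have hTmcont : Continuous Tm := by
    refine continuous_iff_seqContinuous.2 fun y a hya => ?_
    rw [tendsto_subtype_rng]
    show Tendsto (fun j => Φ (nsRescale lam (ρ (y j))) (hPz _ (hρP (y j)) lam hlam)) atTop
      (𝓝 (Φ (nsRescale lam (ρ a)) (hPz _ (hρP a) lam hlam)))
    rw [htend (fun j => nsRescale lam (ρ (y j))) (fun j => hPz _ (hρP (y j)) lam hlam)
      (nsRescale lam (ρ a)) (hPz _ (hρP a) lam hlam)]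
    exact hresc (fun j => ρ (y j)) (ρ a) ((hXtend y a).1 hya) hlam
  -- ## Kryloff–Bogoliouboff: an invariant Borel probability measure on the hull
  obtain ⟨μ, hμ, hμT⟩ :=
    Literature.Dynamics.Ergodic.UniqueErgodicity.exists_isProbabilityMeasure_map_eq hTmcont
  have hmp : MeasurePreserving Tm μ μ := ⟨hTmcont.measurable, hμT⟩
  -- ## Birkhoff along a countable dense family of continuous functions
  obtain ⟨D, hDc, hDd⟩ := TopologicalSpace.exists_countable_dense C(X, ℝ)
  have hD : ∀ᵐ y ∂μ, ∀ g ∈ D, ∃ ℓ : ℝ,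
      Tendsto (fun N => birkhoffAverage ℝ Tm g N y) atTop (𝓝 ℓ) := by
    rw [ae_ball_iff hDc]
    intro g _
    obtain ⟨gstar, -, -, -, hae⟩ := Literature.Dynamics.Ergodic.birkhoff_ergodic_theorem_holds μ Tm hmp
      g ((g : C(X, ℝ)).continuous.integrable_of_hasCompactSupport (HasCompactSupport.of_compactSpace _))
    filter_upwards [hae] with y hy
    exact ⟨gstar y, hy⟩
  haveI : NeZero μ := ⟨IsProbabilityMeasure.ne_zero μ⟩
  obtain ⟨y₀, hy₀⟩ := hD.exists
  -- ## the means of EVERY continuous function converge at `y₀` (Cauchy, `3ε`)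
  have hall : ∀ f : C(X, ℝ), ∃ ℓ : ℝ, Tendsto (fun N => birkhoffAverage ℝ Tm f N y₀) atTop (𝓝 ℓ) := by
    intro f
    have hcomp : ∀ (g : C(X, ℝ)) (N : ℕ),
        dist (birkhoffAverage ℝ Tm f N y₀) (birkhoffAverage ℝ Tm g N y₀) ≤ ‖f - g‖ := by
      intro g N
      have e : ∀ h : C(X, ℝ), birkhoffAverage ℝ Tm h N y₀ =
          (N : ℝ)⁻¹ * ∑ k ∈ Finset.range N, h (Tm^[k] y₀) := fun h => by
        simp only [birkhoffAverage, birkhoffSum, smul_eq_mul]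
      rw [Real.dist_eq, e, e]
      exact abs_cesaro_sub_cesaro_le (fun k => by
        rw [← Real.norm_eq_abs]; exact (f - g).norm_coe_le_norm (Tm^[k] y₀)) N
    refine cauchySeq_tendsto_of_complete (Metric.cauchySeq_iff.2 fun ε hε => ?_)
    obtain ⟨g, hgD, hfg⟩ := hDd.exists_dist_lt f (by positivity : (0 : ℝ) < ε / 3)
    rw [dist_eq_norm] at hfg
    obtain ⟨ℓ, hℓ⟩ := hy₀ g hgD
    obtain ⟨N₀, hN₀⟩ := Metric.cauchySeq_iff.1 hℓ.cauchySeq (ε / 3) (by positivity)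
    refine ⟨N₀, fun m hm n hn => ?_⟩
    have h1 := hcomp g m
    have h2 := hcomp g n
    have h3 := hN₀ m hm n hn
    rw [dist_comm] at h2
    calc dist (birkhoffAverage ℝ Tm f m y₀) (birkhoffAverage ℝ Tm f n y₀)
        ≤ dist (birkhoffAverage ℝ Tm f m y₀) (birkhoffAverage ℝ Tm g m y₀) +
            dist (birkhoffAverage ℝ Tm g m y₀) (birkhoffAverage ℝ Tm g n y₀) +
            dist (birkhoffAverage ℝ Tm g n y₀) (birkhoffAverage ℝ Tm f n y₀) :=
          dist_triangle4 _ _ _ _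
      _ < ε / 3 + ε / 3 + ε / 3 := by linarith
      _ = ε := by ring
  -- ## the quasi-regular element
  set W := ρ y₀ with hWdef
  -- iterates of `𝒯` are represented by the rescalings `W_{λ^k}` on the past
  have hiter : ∀ k : ℕ, ∀ t : ℝ, t < 0 → ∀ x, ρ (Tm^[k] y₀) t x = nsRescale (lam ^ k) W t x := by
    intro k
    induction k with
    | zero => intro t ht x; simp [hWdef]
    | succ k ih =>
      intro t ht x
      rw [Function.iterate_succ_apply']
      have h1 : ∀ t : ℝ, t < 0 → ∀ x, ρ (Tm (Tm^[k] y₀)) t x =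
          nsRescale lam (ρ (Tm^[k] y₀)) t x :=
        hpast_of_eq _ (hρP _) _ (hPz _ (hρP _) lam hlam) (hρΦ (Tm (Tm^[k] y₀)))
      rw [h1 t ht x, nsRescale_apply lam, ih _ (mul_neg_of_pos_of_neg (by positivity) ht)]
      simp only [nsRescale_apply, smul_smul]
      have e1 : lam * lam ^ k = lam ^ (k + 1) := by ring
      have e2 : lam ^ k * lam = lam ^ (k + 1) := by ring
      have e3 : (lam ^ k) ^ 2 * (lam ^ 2 * t) = (lam ^ (k + 1)) ^ 2 * t := by ring
      rw [e1, e2, e3]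
  refine ⟨W, (hρP y₀).1, (hρP y₀).2, hrepS _ y₀.2, hrepR _ y₀.2, ?_, fun G hG => ?_⟩
  · obtain ⟨l, hl, -, hpt⟩ := hrepL _ y₀.2
    exact ⟨l, hl, hpt⟩
  -- a tame observable takes equal values on members that agree on the past ...
  have hGeq : ∀ a b, P a → P b → (∀ t : ℝ, t < 0 → ∀ x, a t x = b t x) → G a = G b := by
    intro a b ha hb hab
    have h1 : Tendsto (fun _ : ℕ => G a) atTop (𝓝 (G b)) := by
      refine hG (fun _ => a) b (fun _ => ha.1) (fun _ => ha.2) hb.1 hb.2 fun n => ?_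
      rw [Metric.tendstoUniformlyOn_iff]
      intro ε hε
      refine Eventually.of_forall fun j z hz => ?_
      rw [hab z.1 (neg_of_mem_slabPiece hz) z.2, dist_self]
      exact hε
    exact tendsto_nhds_unique tendsto_const_nhds h1
  -- ... and factors through a continuous function on the hull
  have hĜc : Continuous fun y : X => G (ρ y) := by
    refine continuous_iff_seqContinuous.2 fun y a hya => ?_
    exact hG (fun j => ρ (y j)) (ρ a) (fun j => (hρP (y j)).1) (fun j => (hρP (y j)).2)
      (hρP a).1 (hρP a).2 ((hXtend y a).1 hya)
  let Ĝ : C(X, ℝ) := ⟨fun y => G (ρ y), hĜc⟩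
  refine ⟨⟨‖Ĝ‖, fun c hc => ?_⟩, ?_⟩
  · -- (a) `G` is bounded on the scaling orbit of `W` (the orbit stays in the compact hull)
    let yc : X := ⟨Φ (nsRescale c W) (hPz _ (hρP y₀) c hc), hρmem y₀ hc⟩
    have h1 : G (nsRescale c W) = Ĝ yc := by
      refine hGeq _ _ (hPz _ (hρP y₀) c hc) (hρP yc) fun t ht x => ?_
      exact (hpast_of_eq _ (hρP yc) _ (hPz _ (hρP y₀) c hc) (hρΦ yc) t ht x).symm
    rw [h1, ← Real.norm_eq_abs]
    exact Ĝ.norm_coe_le_norm yc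
  · -- (b) the Cesàro means along `W_{λ^k}` are Birkhoff averages of `Ĝ` at the generic point
    obtain ⟨ℓ, hℓ⟩ := hall Ĝ
    refine ⟨ℓ, hℓ.congr fun N => ?_⟩
    simp only [birkhoffAverage, birkhoffSum, smul_eq_mul]
    congr 1
    refine Finset.sum_congr rfl fun k _ => ?_
    exact hGeq _ _ (hρP _) (hPz _ (hρP y₀) _ (pow_pos hlam k)) (hiter k)

end Summit.NavierStokesRegularity.NavierStokesRegularity.Theorems.FiniteDissipationLiouville.ErgodicHull

end
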